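import Summits.AtomisticToContinuum.BoseEinsteinCondensation.Theorems.BECNudgeWalkWalkGlue
import Summits.AtomisticToContinuum.BoseEinsteinCondensation.Theorems.BECNudgeWalkNudgedCondensation

/-!
# Skeleton (lead c2) for crux `BECNudgeWalk.NudgeRemoval` — line `registered` (= `birth`)

Item `stmt-AtomisticToContinuum-14361`, route `route-AtomisticToContinuum-BECNudgeWalk`
(sub-problem `BoseEinsteinCondensation`). All analytic stubs of the line have LANDED:
`Registered.stub_nudgedClustering` (p145658), `Registered.stub_depletionOfVariance` (p146702),
`Registered.stub_walkInduction` (p148468), the glue `…WalkStep` (p144338) and the closing file of the route's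
support item `WalkGlue` (stmt-14363): `Theorems/BECNudgeWalkWalkGlue.lean`, `walkGlue_proof : WalkGlue`.
The rung stmt-14362 `NudgedCondensation` is CLOSED `proved` (`Theorems/BECNudgeWalkNudgedCondensation.lean`,
`NudgedCondensationLine.NudgedCondensation_of`) and is used BY NAME below (no stub any more).
What remains are the two SHARED stubs = the route items stmt-14359 `NudgeGap` (crux rank 2) and
stmt-14360 `CondensateVariance` (crux rank 3) BY NAME; when they are proved in `Theorems/`,
`NudgeRemoval_of` below is the closing term (replace each stub by its `_holds` link).
-/

noncomputable section

namespace Summit.AtomisticToContinuum.BoseEinsteinCondensation.Cruxes.NudgeRemoval.Birth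

open Summit.AtomisticToContinuum.BoseEinsteinCondensation.Theses.BECNudgeWalk
open Summit.AtomisticToContinuum.BoseEinsteinCondensation.NudgedCondensationLine (NudgedCondensation_of)

/-! ## Stubs (`sorry` only here) — the two shared route items -/

/-- Stub 2 (shared = route item stmt-AtomisticToContinuum-14359 `NudgeGap`, crux rank 2). -/
theorem stub_nudgeGap : NudgeGap := by
  sorry

/-- Stub 3 (shared = route item stmt-AtomisticToContinuum-14360 `CondensateVariance`, crux rank 3). -/
theorem stub_condensateVariance : CondensateVariance := by
  sorry

/-! ## The assembly -/

/-- **Assembly (registered skeleton theorem).** The crux `NudgeRemoval` BY NAME: the proved route item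
`WalkGlue` (`walkGlue_proof`, from the reward walk) applied to the proved rung `NudgedCondensation_of`
(route item stmt-14362) and the two shared route-item stubs.
`sorry` enters only through the `stub_*` declarations. -/
theorem NudgeRemoval_of : NudgeRemoval :=
  walkGlue_proof NudgedCondensation_of stub_nudgeGap stub_condensateVariance

end Summit.AtomisticToContinuum.BoseEinsteinCondensation.Cruxes.NudgeRemoval.Birth

end
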